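import Summits.FinalStateConjecture.FinalStateConjecture.Theses.PhotonSphereChannels
import Summits.FinalStateConjecture.FinalStateConjecture.Theorems.PhotonSphereChannelsBlindnessMain

/-!
# Route PhotonSphereChannels · item `BlindnessInsidePhotonSphere` (stmt-FinalStateConjecture-10049)

**Theorem** (`blindnessInsidePhotonSphere_proof`): the route decl
`Summit.FinalStateConjecture.FinalStateConjecture.Theses.PhotonSphereChannels.BlindnessInsidePhotonSphere`
holds. For every Schwarzschild mass `M > 0`, tortoise radius `r` (`r' = 1 − 2M/r`, `r > 2M`,
`r(x_c) = 3M`), edge `x_e < x_c` and `ε > 0` there are an angular momentum `ℓ ≥ 2` and a `C²`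
solution `ψ` of the spin-2 Regge–Wheeler equation `ψ_tt − ψ_xx + V_ℓ ψ = 0` with Cauchy data
supported in `(x_e, x_c)`, of finite positive energy `E₀`, whose one-ended far-channel energies
satisfy `liminf_{t→+∞} E[ψ; {x > x_e + |t|}] + liminf_{t→−∞} E[ψ; {x > x_e + |t|}] ≤ ε E₀`.

Proof (all in the `PhotonSphereChannelsBlindness*` support files of this directory): take
`ℓ = m⁴` and the datum `(A, 0)`, `A` a plateau bump of width `3/m³` placed at `x_e`, released at
rest. The light-speed edge of the channel overtakes the support of `A` by the time `T = 4/m³`;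
during that time the true solution (constructed by Picard iteration in null coordinates,
`exists_even_solution`) differs from the frozen oscillation `A(x) cos(√(V_ℓ(x_e)) t)` — which never
enters `{x > x_e + 3/m³}` — by an energy `O(m³)` (energy inequality, `far_energy_le`), channel
energies only decrease afterwards (outgoing null flux `(ψ_t + ψ_x)² + Vψ² ≥ 0`), negative times
follow by evenness, while `E₀ ≳ V_ℓ · m⁻³ ≍ m⁵`; so the ratio is `O(m⁻²) ≤ ε` for `m` large
(`blindness_main`). The photon sphere plays no role: a high-`ℓ` packet at rest is slow, and a
one-ended channel with a light-speed edge starting at its own edge is blind to it.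
-/

noncomputable section

namespace Summit.FinalStateConjecture.FinalStateConjecture.Theses.PhotonSphereChannels

open scoped BigOperators Topology Manifold Classical MeasureTheory ProbabilityTheory Matrix InnerProductSpace ComplexConjugate ContinuousMap
open Filter Set Function TopologicalSpace MeasureTheory

/-- **Record of the replaced/dropped route item `BlindnessInsidePhotonSphere`** = stmt-FinalStateConjecture-10049 (ledger signature verbatim, in
the route file's namespace and `open` context; NOT a route item): after `blindnessInsidePhotonSphere_proof` (below) closed the
item `proved` at d950baf76c44, the route repair (`restate` under a new name, or `drop`) removed
this constant from the gate-written Theses file, while the Theorems file below — append-only,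
statement text fixed — still names it ("Unknown identifier" in the full builds of 2026-08-16).
Re-declared here under its original fully-qualified name and definiens solely so that this record
keeps elaborating. TRUE (proved below). The route dropped it at rev 6 because this proof module imports the route file (render import cycle). -/
def BlindnessInsidePhotonSphere : Prop :=
  ∀ M : ℝ, 0 < M → ∀ (r : ℝ → ℝ) (xc : ℝ), (∀ x, 2 * M < r x) → (∀ x, HasDerivAt r (1 - 2 * M / r x) x) → r xc = 3 * M → ∀ xe : ℝ, xe < xc → ∀ ε : ℝ, 0 < ε → ∃ ℓ : ℕ, 2 ≤ ℓ ∧ ∃ ψ : ℝ → ℝ → ℝ, ContDiff ℝ 2 (Function.uncurry ψ) ∧ let V : ℝ → ℝ := fun x => (1 - 2 * M / r x) * ((ℓ : ℝ) * ((ℓ : ℝ) + 1) / r x ^ 2 + (1 - ((2 : ℕ) : ℝ) ^ 2) * (2 * M) / r x ^ 3); let e : (ℝ → ℝ → ℝ) → ℝ → ℝ → ℝ := fun φ t x => deriv (fun τ => φ τ x) t ^ 2 + deriv (φ t) x ^ 2 + V x * φ t x ^ 2; let IsSol : (ℝ → ℝ → ℝ) → ℝ × ℝ → Prop := fun φ z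 => iteratedDeriv 2 (fun τ => φ τ z.2) z.1 - iteratedDeriv 2 (φ z.1) z.2 + V z.2 * φ z.1 z.2 = 0; let Efar : ℝ → ENNReal := fun t => MeasureTheory.lintegral (MeasureTheory.volume.restrict {x : ℝ | xe + |t| < x}) (fun x => ENNReal.ofReal (e ψ t x)); let E0 : ENNReal := MeasureTheory.lintegral MeasureTheory.volume (fun x => ENNReal.ofReal (e ψ 0 x)); (∀ z, IsSol ψ z) ∧ (∀ x, x ≤ xe ∨ xc ≤ x → ψ 0 x = 0 ∧ deriv (fun τ => ψ τ x) 0 = 0) ∧ 0 < E0 ∧ E0 < ⊤ ∧ Filter.liminf Efar Filter.atTop + Filter.liminf Efar Filter.atBot ≤ ENNReal.ofReal ε * E0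

end Summit.FinalStateConjecture.FinalStateConjecture.Theses.PhotonSphereChannels

namespace Summit.FinalStateConjecture.FinalStateConjecture.Theorems

open Set Filter MeasureTheory Topology Function
open Summit.FinalStateConjecture.FinalStateConjecture.Theorems.Blindness

/-- **Blindness inside the photon sphere** (item stmt-FinalStateConjecture-10049 of route
`PhotonSphereChannels`): one-ended far channels `{x > x_e + |t|}` with `x_e < x_c` do not control
the energy of Regge–Wheeler solutions with data supported in `(x_e, x_c)`, uniformly in `ℓ`. -/
theorem blindnessInsidePhotonSphere_proof :
    Summit.FinalStateConjecture.FinalStateConjecture.Theses.PhotonSphereChannels.BlindnessInsidePhotonSphere := by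
  unfold Summit.FinalStateConjecture.FinalStateConjecture.Theses.PhotonSphereChannels.BlindnessInsidePhotonSphere
  intro M hM r xc hr hr' _hxc xe hxe ε hε
  -- constants of the bump and of the potential on `[x_e, x_e + 3]`
  obtain ⟨B, hB, h0l, h0r, h1, h01, K₂, hK₂, hB2⟩ := exists_profile
  obtain ⟨f₀, C₀, C₁, hf₀, hC₀, hC₁, hK⟩ :=
    potential_compact_bounds hM hr hr' (a := xe) (b := xe + 3) (by linarith)
  -- the scale `m`
  obtain ⟨m, hm⟩ := exists_nat_gt (max (max 2 (3 / (xc - xe)))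
    (max (2 * C₀ / f₀) (Real.sqrt (384 * (9 * C₁ + K₂) ^ 2 / (ε * f₀)))))
  have hm2r : (2 : ℝ) < m := lt_of_le_of_lt ((le_max_left _ _).trans (le_max_left _ _)) hm
  have hm2 : 2 ≤ m := by
    have : (2 : ℕ) < m := by exact_mod_cast hm2r
    omega
  have hm0 : (0 : ℝ) < m := by linarith
  have hm3 : 3 / (xc - xe) < m := lt_of_le_of_lt ((le_max_right _ _).trans (le_max_left _ _)) hm
  have hmC : 2 * C₀ / f₀ ≤ m := (lt_of_le_of_lt ((le_max_left _ _).trans (le_max_right _ _)) hm).le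
  have hmε : 384 * (9 * C₁ + K₂) ^ 2 / (ε * f₀) ≤ (m : ℝ) ^ 2 := by
    have h := lt_of_le_of_lt ((le_max_right _ _).trans (le_max_right _ _)) hm
    exact ((Real.sqrt_lt' hm0).1 h).le
  have hℓ2 : 2 ≤ m ^ 4 := le_trans hm2 (Nat.le_self_pow (by norm_num) m)
  -- the packet
  obtain ⟨ψ, hψ2, hsol, hdata, he0, hInt, E0r, bd, Tb, hE0, hE0eq, hbd, hkey, hfar⟩ :=
    blindness_main hM hr hr' hxe hε hB h0l h0r h1 h01 hK₂ hB2 hf₀ hC₁ (fun ℓ => (hK ℓ).1)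
      (fun ℓ => (hK ℓ).2) hm2 hm3 hmC hmε (m ^ 4) rfl _ rfl
  refine ⟨m ^ 4, hℓ2, ψ, hψ2, ?_⟩
  intro V e IsSol Efar E0
  -- conversions between the statement's `lintegral`s and Bochner integrals
  have hE0conv : E0 = ENNReal.ofReal E0r := by
    rw [← hE0eq]
    exact (ofReal_integral_eq_lintegral_ofReal (hInt 0) (Eventually.of_forall (he0 0))).symm
  have hEfar : ∀ t, Efar t = ENNReal.ofReal (∫ x in Ioi (xe + |t|),
      (deriv (fun τ => ψ τ x) t ^ 2 + deriv (ψ t) x ^ 2 + V x * ψ t x ^ 2)) := fun t =>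
    (ofReal_integral_eq_lintegral_ofReal ((hInt t).restrict (s := Ioi (xe + |t|)))
      (Eventually.of_forall (he0 t))).symm
  have hbound : ∀ t, |Tb| ≤ |t| → Efar t ≤ ENNReal.ofReal bd := fun t ht => by
    rw [hEfar t]
    exact ENNReal.ofReal_le_ofReal (hfar t ((le_abs_self Tb).trans ht))
  refine ⟨fun z => hsol z.1 z.2, hdata, ?_, ?_, ?_⟩
  · rw [hE0conv]; exact ENNReal.ofReal_pos.2 hE0
  · rw [hE0conv]; exact ENNReal.ofReal_lt_top
  · have h1 : Filter.liminf Efar Filter.atTop ≤ ENNReal.ofReal bd := by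
      refine Filter.liminf_le_of_frequently_le' (Filter.Eventually.frequently ?_)
      filter_upwards [Filter.eventually_ge_atTop |Tb|] with t ht
      exact hbound t (ht.trans (le_abs_self t))
    have h2 : Filter.liminf Efar Filter.atBot ≤ ENNReal.ofReal bd := by
      refine Filter.liminf_le_of_frequently_le' (Filter.Eventually.frequently ?_)
      filter_upwards [Filter.eventually_le_atBot (-|Tb|)] with t ht
      exact hbound t (by linarith [neg_abs_le t, abs_nonneg t, neg_le_abs t])
    calc Filter.liminf Efar Filter.atTop + Filter.liminf Efar Filter.atBot
        ≤ ENNReal.ofReal bd + ENNReal.ofReal bd := add_le_add h1 h2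
      _ = ENNReal.ofReal (2 * bd) := by rw [two_mul, ENNReal.ofReal_add hbd hbd]
      _ ≤ ENNReal.ofReal (ε * E0r) := ENNReal.ofReal_le_ofReal hkey
      _ = ENNReal.ofReal ε * E0 := by rw [hE0conv, ENNReal.ofReal_mul hε.le]

end Summit.FinalStateConjecture.FinalStateConjecture.Theorems

end
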